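import Summits.BirchSwinnertonDyer.BirchSwinnertonDyer.Theorems.BiquadraticEisensteinDescentHeegnerTwistCouplingInSupplySymbolicMonskyEvenDesignRows
import Summits.BirchSwinnertonDyer.BirchSwinnertonDyer.Theorems.BiquadraticEisensteinDescentHeegnerTwistCouplingInSupplySymbolicMonskyLeftKernel
import HarnessLib

set_option linter.dupNamespace false -- `Summit.BirchSwinnertonDyer.BirchSwinnertonDyer.Theorems.…` (summit = sub)
set_option autoImplicit false

/-!
# Crux `HeegnerTwistCouplingInSupply` (stmt-BirchSwinnertonDyer-21381) — Z-DESIGNS ON THE EVEN BASES, part 2: the EVEN pairing, the core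
# (stages `u` and `v` at once) and injectivity on `Q`-constant vectors

Route `BiquadraticEisensteinDescent` (cell `pub/bsd-wall`, width seat `bsd-wall-cm-bed-w3` g23; `--supports` 21381, helper). The even twin of
`…SymbolicMonskyDesignCore`. Setting: base datum `base`, cells `c₁ :: rest` (`…EvenDesignRows`), reference EVEN matrix `M`.

* ★ `even_pairing_identity` (pure algebra, any base): `⟨λ, E1(u,v)⟩ + ⟨μ, E2(u,v,V₀)⟩ = ⟨u, (L+D_m+D_d)λ + D_dμ⟩ + ⟨v, D_mλ + Lμ + ⟨m,μ⟩m + D_dμ⟩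
  + ⟨m,μ⟩V₀` (the transpose identity `⟨a,Lc⟩ + ⟨c,La⟩ = ⟨m,a⟩⟨m,c⟩ + ⟨m⊙a,c⟩` of `…SymbolicMonskyLeftKernel`, twice);
* ★ `even_design_pairing`: for `z` killed by the base rows and the auxiliary row-sums and ANY EVEN LEFT PAIR `(λ, μ)`
  (`(L+D_m+D_d)λ + D_dμ + ⟨m,μ⟩m = 0`, `D_mλ + Lμ + ⟨m,μ⟩m + D_dμ = 0`): `Σ_i (a_i (⟨σ_i,λ⟩ + ⟨m,μ⟩(c_i + d'_i)) + e_i ⟨σ_i,μ⟩) = 0` — the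
  EVEN PENCIL pairs `(λ + ⟨m,μ⟩(1+δ), μ)` of memo THEOREM-A-w3g22 §6b. DUALITY (observed this session, 600/600 numerically, and a tautology in these
  coordinates): the even left pair equations for `(λ, μ)` ARE the right kernel equations (E1), (E2) (with `V₀ = ⟨m,u⟩`) for `(u, v) := (μ, λ)` —
  so, exactly as in the odd case, ONE space carries both (span) and (inj);
* ★ `even_design_core` — (span) ⇒ `z` is constant on the auxiliary block in BOTH halves (`a = e = 0`);
* ★ `even_design_S3` — (inj) ⇒ `M` kills no non-zero `Q`-constant vector.

HONEST FRAMING: linear algebra over `𝔽₂`; RUNG-LEVEL corner layer; the crux (C⁺), its registered stubs and BSD are untouched; nothing is closed.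
THEOREMS ONLY. Reference: [HeathBrown1994] appendix (Monsky), typescript p. 41.
-/

namespace Summit.BirchSwinnertonDyer.BirchSwinnertonDyer.Theorems.SymbolicMonsky

section EvenPairing

open Matrix

variable {k : ℕ} (base : SymbData (k + 1))

/-- ★ **The EVEN pairing identity** (pure algebra, any base): pairing the left-hand sides of the even design identities (E1), (E2) against a
test pair `(λ, μ)` moves the Laplacians onto `(λ, μ)` (transpose identity `⟨a, Lc⟩ + ⟨c, La⟩ = ⟨m,a⟩⟨m,c⟩ + ⟨m⊙a, c⟩`):
`⟨λ, E1(u,v)⟩ + ⟨μ, E2(u,v,V₀)⟩ = ⟨u, P1(λ,μ)⟩ + ⟨v, P2(λ,μ)⟩ + ⟨m,μ⟩·V₀` with `P1 = (L + D_m + D_d)λ + D_d μ`,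
`P2 = D_m λ + Lμ + ⟨m,μ⟩ m + D_d μ`. [folklore] -/
theorem even_pairing_identity (lam mu u v : Fin (k + 1) → ZMod 2) (V0 : ZMod 2) :
    (∑ b, lam b * ((∑ b', bz (base.neg b b') * (u b' + u b)) +
        bz (negNegOne (base.cls b)) * (∑ b', bz (negNegOne (base.cls b')) * u b') +
        bz (negTwo (base.cls b)) * u b + bz (negNegOne (base.cls b)) * v b)) +
    (∑ b, mu b * (bz (negTwo (base.cls b)) * u b + (∑ b', bz (base.neg b b') * (v b' + v b)) +
        bz (negNegOne (base.cls b)) * v b + bz (negTwo (base.cls b)) * v b + bz (negNegOne (base.cls b)) * V0)) =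
    (∑ b, u b * ((∑ b', bz (base.neg b b') * (lam b' + lam b)) + bz (negNegOne (base.cls b)) * lam b +
        bz (negTwo (base.cls b)) * lam b + bz (negTwo (base.cls b)) * mu b)) +
    (∑ b, v b * (bz (negNegOne (base.cls b)) * lam b + (∑ b', bz (base.neg b b') * (mu b' + mu b)) +
        bz (negNegOne (base.cls b)) * (∑ b', bz (negNegOne (base.cls b')) * mu b') + bz (negTwo (base.cls b)) * mu b)) +
    (∑ b, bz (negNegOne (base.cls b)) * mu b) * V0 := by
  have T1 := base.sum_sum_neg_transpose lam u
  have T2 := base.sum_sum_neg_transpose mu v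
  -- name the atoms
  set A1 := ∑ b, lam b * ∑ b', bz (base.neg b b') * (u b' + u b) with hA1
  set A2 := ∑ b, u b * ∑ b', bz (base.neg b b') * (lam b' + lam b) with hA2
  set B1 := ∑ b, mu b * ∑ b', bz (base.neg b b') * (v b' + v b) with hB1
  set B2 := ∑ b, v b * ∑ b', bz (base.neg b b') * (mu b' + mu b) with hB2
  set Ml := ∑ b, bz (negNegOne (base.cls b)) * lam b with hMl
  set Mu := ∑ b, bz (negNegOne (base.cls b)) * u b with hMu
  set Mm := ∑ b, bz (negNegOne (base.cls b)) * mu b with hMm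
  set Mv := ∑ b, bz (negNegOne (base.cls b)) * v b with hMv
  have hL : (∑ b, lam b * ((∑ b', bz (base.neg b b') * (u b' + u b)) +
        bz (negNegOne (base.cls b)) * (∑ b', bz (negNegOne (base.cls b')) * u b') +
        bz (negTwo (base.cls b)) * u b + bz (negNegOne (base.cls b)) * v b)) =
      A1 + Ml * Mu + (∑ b, bz (negTwo (base.cls b)) * lam b * u b) + ∑ b, bz (negNegOne (base.cls b)) * lam b * v b := by
    rw [hA1, hMl, hMu, Finset.sum_mul, ← Finset.sum_add_distrib, ← Finset.sum_add_distrib, ← Finset.sum_add_distrib]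
    exact Finset.sum_congr rfl fun b _ => by ring
  have hM : (∑ b, mu b * (bz (negTwo (base.cls b)) * u b + (∑ b', bz (base.neg b b') * (v b' + v b)) +
        bz (negNegOne (base.cls b)) * v b + bz (negTwo (base.cls b)) * v b + bz (negNegOne (base.cls b)) * V0)) =
      (∑ b, bz (negTwo (base.cls b)) * mu b * u b) + B1 + (∑ b, bz (negNegOne (base.cls b)) * mu b * v b) +
        (∑ b, bz (negTwo (base.cls b)) * mu b * v b) + Mm * V0 := by
    rw [hB1, hMm, Finset.sum_mul, ← Finset.sum_add_distrib, ← Finset.sum_add_distrib, ← Finset.sum_add_distrib,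
      ← Finset.sum_add_distrib]
    exact Finset.sum_congr rfl fun b _ => by ring
  have hR1 : (∑ b, u b * ((∑ b', bz (base.neg b b') * (lam b' + lam b)) + bz (negNegOne (base.cls b)) * lam b +
        bz (negTwo (base.cls b)) * lam b + bz (negTwo (base.cls b)) * mu b)) =
      A2 + (∑ b, bz (negNegOne (base.cls b)) * lam b * u b) + (∑ b, bz (negTwo (base.cls b)) * lam b * u b) +
        ∑ b, bz (negTwo (base.cls b)) * mu b * u b := by
    rw [hA2, ← Finset.sum_add_distrib, ← Finset.sum_add_distrib, ← Finset.sum_add_distrib]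
    exact Finset.sum_congr rfl fun b _ => by ring
  have hR2 : (∑ b, v b * (bz (negNegOne (base.cls b)) * lam b + (∑ b', bz (base.neg b b') * (mu b' + mu b)) +
        bz (negNegOne (base.cls b)) * (∑ b', bz (negNegOne (base.cls b')) * mu b') + bz (negTwo (base.cls b)) * mu b)) =
      (∑ b, bz (negNegOne (base.cls b)) * lam b * v b) + B2 + Mv * Mm + ∑ b, bz (negTwo (base.cls b)) * mu b * v b := by
    rw [hB2, hMv, Finset.sum_mul, ← Finset.sum_add_distrib, ← Finset.sum_add_distrib, ← Finset.sum_add_distrib]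
    exact Finset.sum_congr rfl fun b _ => by ring
  rw [hL, hM, hR1, hR2]
  have T1' : A1 + A2 = Ml * Mu + ∑ b, bz (negNegOne (base.cls b)) * lam b * u b := T1
  have T2' : B1 + B2 = Mm * Mv + ∑ b, bz (negNegOne (base.cls b)) * mu b * v b := T2
  set Dlu := ∑ b, bz (negNegOne (base.cls b)) * lam b * u b
  set Dmv := ∑ b, bz (negNegOne (base.cls b)) * mu b * v b
  set X1 := ∑ b, bz (negTwo (base.cls b)) * lam b * u b
  set X2 := ∑ b, bz (negNegOne (base.cls b)) * lam b * v b
  set X3 := ∑ b, bz (negTwo (base.cls b)) * mu b * u b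
  set X4 := ∑ b, bz (negTwo (base.cls b)) * mu b * v b
  linear_combination (norm := skip) T1' + T2'
  ring_nf
  try reduce_mod_char

end EvenPairing

section EvenDesignCore

open Matrix

variable {k : ℕ} (base : SymbData (k + 1)) (c₁ : AuxCell) (rest : List AuxCell)

/-- ★ **The EVEN left pairing of a design.** For `z` killed by the base rows and the two auxiliary row-sums of the reference EVEN matrix and
ANY even left pair `(λ, μ)` (`(L + D_m + D_d)λ + D_d μ + ⟨m,μ⟩m = 0`, `D_m λ + Lμ + ⟨m,μ⟩m + D_d μ = 0`):
`Σ_i (a_i (⟨σ_i, λ⟩ + ⟨m,μ⟩(c_i + d'_i)) + e_i ⟨σ_i, μ⟩) = 0` (`a_i`, `e_i` the `u`- and `v`-differences of `z` on the auxiliary block).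
[folklore] -/
theorem even_design_pairing (hm1 : negNegOne c₁.1 = true) (hmr : ∀ i : Fin rest.length, negNegOne (rest.getD i.val (0, 0)).1 = false)
    (σ : Fin rest.length → Fin (k + 1) → ZMod 2) (hσ : ∀ i b, bz ((rest.getD i.val (0, 0)).2.testBit b.val) = σ i b)
    (hσ1 : ∀ b : Fin (k + 1), bz (c₁.2.testBit b.val) = bz (negNegOne (base.cls b)) + ∑ i, σ i b)
    (dp : Fin rest.length → ZMod 2) (hdp : ∀ i, bz (negTwo (rest.getD i.val (0, 0)).1) = dp i)
    (hd1 : bz (negTwo c₁.1) = ∑ i, dp i)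
    (z : Fin (k + 1 + (c₁ :: rest).length) ⊕ Fin (k + 1 + (c₁ :: rest).length) → ZMod 2)
    (hrow1 : ∀ b : Fin (k + 1), ((dataK base (c₁ :: rest) (fun _ _ => false)).monskyEvenS *ᵥ z) (Sum.inl (Fin.castAdd _ b)) = 0)
    (hrow2 : ∀ b : Fin (k + 1), ((dataK base (c₁ :: rest) (fun _ _ => false)).monskyEvenS *ᵥ z) (Sum.inr (Fin.castAdd _ b)) = 0)
    (hs1 : (∑ j : Fin (c₁ :: rest).length,
      ((dataK base (c₁ :: rest) (fun _ _ => false)).monskyEvenS *ᵥ z) (Sum.inl (Fin.natAdd (k + 1) j))) = 0)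
    (hs2 : (∑ j : Fin (c₁ :: rest).length,
      ((dataK base (c₁ :: rest) (fun _ _ => false)).monskyEvenS *ᵥ z) (Sum.inr (Fin.natAdd (k + 1) j))) = 0)
    (lam mu : Fin (k + 1) → ZMod 2)
    (hL1 : ∀ b, (∑ b', bz (base.neg b b') * (lam b' + lam b)) + bz (negNegOne (base.cls b)) * lam b +
        bz (negTwo (base.cls b)) * lam b + bz (negTwo (base.cls b)) * mu b +
        bz (negNegOne (base.cls b)) * (∑ b', bz (negNegOne (base.cls b')) * mu b') = 0)
    (hL2 : ∀ b, bz (negNegOne (base.cls b)) * lam b + (∑ b', bz (base.neg b b') * (mu b' + mu b)) +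
        bz (negNegOne (base.cls b)) * (∑ b', bz (negNegOne (base.cls b')) * mu b') + bz (negTwo (base.cls b)) * mu b = 0) :
    (∑ i : Fin rest.length,
      ((z (Sum.inl (Fin.natAdd (k + 1) (⟨i.val + 1, by simp⟩ : Fin (c₁ :: rest).length))) +
          z (Sum.inl (Fin.natAdd (k + 1) (⟨0, by simp⟩ : Fin (c₁ :: rest).length)))) *
        ((∑ b, σ i b * lam b) + (∑ b, bz (negNegOne (base.cls b)) * mu b) * ((∑ b, σ i b) + dp i)) +
       (z (Sum.inr (Fin.natAdd (k + 1) (⟨i.val + 1, by simp⟩ : Fin (c₁ :: rest).length))) +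
          z (Sum.inr (Fin.natAdd (k + 1) (⟨0, by simp⟩ : Fin (c₁ :: rest).length)))) * (∑ b, σ i b * mu b))) = 0 := by
  set q0 : Fin (c₁ :: rest).length := ⟨0, by simp⟩ with hq0
  set U0 := z (Sum.inl (Fin.natAdd (k + 1) q0)) with hU0
  set V0 := z (Sum.inr (Fin.natAdd (k + 1) q0)) with hV0
  set U : Fin rest.length → ZMod 2 := fun i => z (Sum.inl (Fin.natAdd (k + 1) (⟨i.val + 1, by simp⟩ : Fin (c₁ :: rest).length))) with hU
  set V : Fin rest.length → ZMod 2 := fun i => z (Sum.inr (Fin.natAdd (k + 1) (⟨i.val + 1, by simp⟩ : Fin (c₁ :: rest).length))) with hV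
  set u : Fin (k + 1) → ZMod 2 := fun b => z (Sum.inl (Fin.castAdd (c₁ :: rest).length b)) with hu
  set v : Fin (k + 1) → ZMod 2 := fun b => z (Sum.inr (Fin.castAdd (c₁ :: rest).length b)) with hv
  obtain ⟨E1, E2, -, E4⟩ := even_design_identities base c₁ rest hm1 hmr σ hσ hσ1 dp hdp hd1 z hrow1 hrow2 hs1 hs2
  have P := even_pairing_identity base lam mu u v V0
  have E1' : ∀ b, (∑ b', bz (base.neg b b') * (u b' + u b)) +
      bz (negNegOne (base.cls b)) * (∑ b', bz (negNegOne (base.cls b')) * u b') +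
      bz (negTwo (base.cls b)) * u b + bz (negNegOne (base.cls b)) * v b = ∑ i, σ i b * (U i + U0) := E1
  have E2' : ∀ b, bz (negTwo (base.cls b)) * u b + (∑ b', bz (base.neg b b') * (v b' + v b)) +
      bz (negNegOne (base.cls b)) * v b + bz (negTwo (base.cls b)) * v b + bz (negNegOne (base.cls b)) * V0 =
      ∑ i, σ i b * (V i + V0) := E2
  have E4' : V0 = (∑ b', bz (negNegOne (base.cls b')) * u b') + ∑ i, ((∑ b', σ i b') + dp i) * (U i + U0) := E4
  -- the left pair kills `u` up to `⟨m,μ⟩ m` and kills `v`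
  have P1 : ∀ b, (∑ b', bz (base.neg b b') * (lam b' + lam b)) + bz (negNegOne (base.cls b)) * lam b +
      bz (negTwo (base.cls b)) * lam b + bz (negTwo (base.cls b)) * mu b =
      bz (negNegOne (base.cls b)) * (∑ b', bz (negNegOne (base.cls b')) * mu b') := fun b =>
    (zmod_two_eq_iff_add_eq_zero _ _).mpr (hL1 b)
  simp only [E1', E2', P1, hL2, mul_zero, Finset.sum_const_zero, add_zero] at P
  -- swap the double sums
  have swap : ∀ (g : Fin (k + 1) → ZMod 2) (F : Fin rest.length → ZMod 2),
      (∑ b, g b * ∑ i, σ i b * F i) = ∑ i, F i * ∑ b, σ i b * g b := by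
    intro g F
    have e : (∑ b, g b * ∑ i, σ i b * F i) = ∑ b, ∑ i, g b * (σ i b * F i) :=
      Finset.sum_congr rfl fun b _ => Finset.mul_sum _ _ _
    rw [e, Finset.sum_comm]
    refine Finset.sum_congr rfl fun i _ => ?_
    rw [Finset.mul_sum]
    exact Finset.sum_congr rfl fun b _ => by ring
  set Mm := ∑ b, bz (negNegOne (base.cls b)) * mu b with hMm
  set Mu := ∑ b', bz (negNegOne (base.cls b')) * u b' with hMu
  have F3 : (∑ b, u b * (bz (negNegOne (base.cls b)) * Mm)) = Mm * Mu := by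
    rw [hMu, Finset.mul_sum]; exact Finset.sum_congr rfl fun b _ => by ring
  rw [swap lam (fun i => U i + U0), swap mu (fun i => V i + V0), F3] at P
  set κ := ∑ i, ((∑ b', σ i b') + dp i) * (U i + U0) with hκ
  have E4'' : V0 = Mu + κ := E4'
  have hκ' : Mm * κ = ∑ i, (U i + U0) * (Mm * ((∑ b, σ i b) + dp i)) := by
    rw [hκ, Finset.mul_sum]; exact Finset.sum_congr rfl fun i _ => by ring
  have goal_eq : (∑ i, ((U i + U0) * ((∑ b, σ i b * lam b) + Mm * ((∑ b, σ i b) + dp i)) + (V i + V0) * (∑ b, σ i b * mu b))) =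
      (∑ i, (U i + U0) * ∑ b, σ i b * lam b) + Mm * κ + ∑ i, (V i + V0) * ∑ b, σ i b * mu b := by
    rw [hκ', ← Finset.sum_add_distrib, ← Finset.sum_add_distrib]
    exact Finset.sum_congr rfl fun i _ => by ring
  rw [goal_eq]
  set Al := ∑ i, (U i + U0) * ∑ b, σ i b * lam b
  set Am := ∑ i, (V i + V0) * ∑ b, σ i b * mu b
  linear_combination (norm := skip) P + Mm * E4''
  ring_nf
  try reduce_mod_char

end EvenDesignCore

section EvenDesign

open Matrix

variable {k : ℕ} (base : SymbData (k + 1)) (c₁ : AuxCell) (rest : List AuxCell)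

/-- ★ **Core of an EVEN design** (stages `u` and `v` at once). If the pairs `(⟨σ_i,λ⟩ + ⟨m,μ⟩(c_i + d'_i), ⟨σ_i,μ⟩)` over the even left pairs
`(λ, μ)` together with `(d'_i, c_i + d'_i)` span `𝔽₂^τ × 𝔽₂^τ` (`hspan`: the only `(a, e)` orthogonal to all of them is `0`), then every `z`
killed by the base rows and the two auxiliary row-sums of the reference even matrix is constant on the auxiliary block in BOTH halves. [folklore] -/
theorem even_design_core (hm1 : negNegOne c₁.1 = true) (hmr : ∀ i : Fin rest.length, negNegOne (rest.getD i.val (0, 0)).1 = false)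
    (σ : Fin rest.length → Fin (k + 1) → ZMod 2) (hσ : ∀ i b, bz ((rest.getD i.val (0, 0)).2.testBit b.val) = σ i b)
    (hσ1 : ∀ b : Fin (k + 1), bz (c₁.2.testBit b.val) = bz (negNegOne (base.cls b)) + ∑ i, σ i b)
    (dp : Fin rest.length → ZMod 2) (hdp : ∀ i, bz (negTwo (rest.getD i.val (0, 0)).1) = dp i)
    (hd1 : bz (negTwo c₁.1) = ∑ i, dp i)
    (hspan : ∀ a e : Fin rest.length → ZMod 2,
      (∀ lam mu : Fin (k + 1) → ZMod 2,
        (∀ b, (∑ b', bz (base.neg b b') * (lam b' + lam b)) + bz (negNegOne (base.cls b)) * lam b +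
          bz (negTwo (base.cls b)) * lam b + bz (negTwo (base.cls b)) * mu b +
          bz (negNegOne (base.cls b)) * (∑ b', bz (negNegOne (base.cls b')) * mu b') = 0) →
        (∀ b, bz (negNegOne (base.cls b)) * lam b + (∑ b', bz (base.neg b b') * (mu b' + mu b)) +
          bz (negNegOne (base.cls b)) * (∑ b', bz (negNegOne (base.cls b')) * mu b') + bz (negTwo (base.cls b)) * mu b = 0) →
        (∑ i, (a i * ((∑ b, σ i b * lam b) + (∑ b, bz (negNegOne (base.cls b)) * mu b) * ((∑ b, σ i b) + dp i)) +
          e i * (∑ b, σ i b * mu b))) = 0) →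
      (∑ i, (dp i * a i + ((∑ b, σ i b) + dp i) * e i)) = 0 → (∀ i, a i = 0) ∧ (∀ i, e i = 0))
    (z : Fin (k + 1 + (c₁ :: rest).length) ⊕ Fin (k + 1 + (c₁ :: rest).length) → ZMod 2)
    (hrow1 : ∀ b : Fin (k + 1), ((dataK base (c₁ :: rest) (fun _ _ => false)).monskyEvenS *ᵥ z) (Sum.inl (Fin.castAdd _ b)) = 0)
    (hrow2 : ∀ b : Fin (k + 1), ((dataK base (c₁ :: rest) (fun _ _ => false)).monskyEvenS *ᵥ z) (Sum.inr (Fin.castAdd _ b)) = 0)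
    (hs1 : (∑ j : Fin (c₁ :: rest).length,
      ((dataK base (c₁ :: rest) (fun _ _ => false)).monskyEvenS *ᵥ z) (Sum.inl (Fin.natAdd (k + 1) j))) = 0)
    (hs2 : (∑ j : Fin (c₁ :: rest).length,
      ((dataK base (c₁ :: rest) (fun _ _ => false)).monskyEvenS *ᵥ z) (Sum.inr (Fin.natAdd (k + 1) j))) = 0) :
    ∀ i : Fin rest.length,
      z (Sum.inl (Fin.natAdd (k + 1) (⟨i.val + 1, by simp⟩ : Fin (c₁ :: rest).length))) =
        z (Sum.inl (Fin.natAdd (k + 1) (⟨0, by simp⟩ : Fin (c₁ :: rest).length))) ∧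
      z (Sum.inr (Fin.natAdd (k + 1) (⟨i.val + 1, by simp⟩ : Fin (c₁ :: rest).length))) =
        z (Sum.inr (Fin.natAdd (k + 1) (⟨0, by simp⟩ : Fin (c₁ :: rest).length))) := by
  set q0 : Fin (c₁ :: rest).length := ⟨0, by simp⟩ with hq0
  set U0 := z (Sum.inl (Fin.natAdd (k + 1) q0)) with hU0
  set V0 := z (Sum.inr (Fin.natAdd (k + 1) q0)) with hV0
  set U : Fin rest.length → ZMod 2 := fun i => z (Sum.inl (Fin.natAdd (k + 1) (⟨i.val + 1, by simp⟩ : Fin (c₁ :: rest).length))) with hU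
  set V : Fin rest.length → ZMod 2 := fun i => z (Sum.inr (Fin.natAdd (k + 1) (⟨i.val + 1, by simp⟩ : Fin (c₁ :: rest).length))) with hV
  obtain ⟨-, -, E3, -⟩ := even_design_identities base c₁ rest hm1 hmr σ hσ hσ1 dp hdp hd1 z hrow1 hrow2 hs1 hs2
  have Pr : ∀ lam mu : Fin (k + 1) → ZMod 2,
      (∀ b, (∑ b', bz (base.neg b b') * (lam b' + lam b)) + bz (negNegOne (base.cls b)) * lam b +
        bz (negTwo (base.cls b)) * lam b + bz (negTwo (base.cls b)) * mu b +
        bz (negNegOne (base.cls b)) * (∑ b', bz (negNegOne (base.cls b')) * mu b') = 0) →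
      (∀ b, bz (negNegOne (base.cls b)) * lam b + (∑ b', bz (base.neg b b') * (mu b' + mu b)) +
        bz (negNegOne (base.cls b)) * (∑ b', bz (negNegOne (base.cls b')) * mu b') + bz (negTwo (base.cls b)) * mu b = 0) →
      (∑ i, ((U i + U0) * ((∑ b, σ i b * lam b) + (∑ b, bz (negNegOne (base.cls b)) * mu b) * ((∑ b, σ i b) + dp i)) +
        (V i + V0) * (∑ b, σ i b * mu b))) = 0 :=
    fun lam mu hL1 hL2 => even_design_pairing base c₁ rest hm1 hmr σ hσ hσ1 dp hdp hd1 z hrow1 hrow2 hs1 hs2 lam mu hL1 hL2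
  have E3' : (∑ i, (dp i * (U i + U0) + ((∑ b, σ i b) + dp i) * (V i + V0))) = 0 := E3
  obtain ⟨ha, he⟩ := hspan (fun i => U i + U0) (fun i => V i + V0) Pr E3'
  intro i
  exact ⟨(zmod_two_eq_iff_add_eq_zero _ _).mpr (ha i), (zmod_two_eq_iff_add_eq_zero _ _).mpr (he i)⟩

/-- ★ **Injectivity on `Q`-constant vectors (stage S3) for an EVEN design.** Hypothesis `hF`: the only `(u, v, U₀, V₀)` with
`(Lᵀ + D_d)u + D_m(u + v) = 0`, `D_d u + (L + D_m + D_d) v + V₀ m = 0`, `V₀ = ⟨m, u⟩`, `⟨σ_i, u⟩ + (c_i + d'_i) U₀ = 0`,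
`⟨σ_i, v⟩ + c_i V₀ + d'_i (U₀ + V₀) = 0` (all `i`) is zero. Then the reference even matrix kills no non-zero vector that is constant on the
auxiliary block in both halves. [folklore] -/
theorem even_design_S3 (hm1 : negNegOne c₁.1 = true) (hmr : ∀ i : Fin rest.length, negNegOne (rest.getD i.val (0, 0)).1 = false)
    (σ : Fin rest.length → Fin (k + 1) → ZMod 2) (hσ : ∀ i b, bz ((rest.getD i.val (0, 0)).2.testBit b.val) = σ i b)
    (hσ1 : ∀ b : Fin (k + 1), bz (c₁.2.testBit b.val) = bz (negNegOne (base.cls b)) + ∑ i, σ i b)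
    (dp : Fin rest.length → ZMod 2) (hdp : ∀ i, bz (negTwo (rest.getD i.val (0, 0)).1) = dp i)
    (hd1 : bz (negTwo c₁.1) = ∑ i, dp i)
    (hF : ∀ (u v : Fin (k + 1) → ZMod 2) (U0 V0 : ZMod 2),
      (∀ b, (∑ b', bz (base.neg b b') * (u b' + u b)) +
        bz (negNegOne (base.cls b)) * (∑ b', bz (negNegOne (base.cls b')) * u b') +
        bz (negTwo (base.cls b)) * u b + bz (negNegOne (base.cls b)) * v b = 0) →
      (∀ b, bz (negTwo (base.cls b)) * u b + (∑ b', bz (base.neg b b') * (v b' + v b)) +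
        bz (negNegOne (base.cls b)) * v b + bz (negTwo (base.cls b)) * v b + bz (negNegOne (base.cls b)) * V0 = 0) →
      V0 = (∑ b', bz (negNegOne (base.cls b')) * u b') →
      (∀ i, (∑ b, σ i b * u b) + ((∑ b, σ i b) + dp i) * U0 = 0) →
      (∀ i, (∑ b, σ i b * v b) + (∑ b, σ i b) * V0 + dp i * (U0 + V0) = 0) →
      u = 0 ∧ v = 0 ∧ U0 = 0 ∧ V0 = 0)
    (z : Fin (k + 1 + (c₁ :: rest).length) ⊕ Fin (k + 1 + (c₁ :: rest).length) → ZMod 2)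
    (hconst : ∀ i j, auxQ k (c₁ :: rest).length i = true → auxQ k (c₁ :: rest).length j = true →
      z (Sum.inl i) = z (Sum.inl j) ∧ z (Sum.inr i) = z (Sum.inr j))
    (hz : (dataK base (c₁ :: rest) (fun _ _ => false)).monskyEvenS *ᵥ z = 0) : z = 0 := by
  set q0 : Fin (c₁ :: rest).length := ⟨0, by simp⟩ with hq0
  set U0 := z (Sum.inl (Fin.natAdd (k + 1) q0)) with hU0
  set V0 := z (Sum.inr (Fin.natAdd (k + 1) q0)) with hV0
  set U : Fin rest.length → ZMod 2 := fun i => z (Sum.inl (Fin.natAdd (k + 1) (⟨i.val + 1, by simp⟩ : Fin (c₁ :: rest).length))) with hU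
  set V : Fin rest.length → ZMod 2 := fun i => z (Sum.inr (Fin.natAdd (k + 1) (⟨i.val + 1, by simp⟩ : Fin (c₁ :: rest).length))) with hV
  set u : Fin (k + 1) → ZMod 2 := fun b => z (Sum.inl (Fin.castAdd (c₁ :: rest).length b)) with hu
  set v : Fin (k + 1) → ZMod 2 := fun b => z (Sum.inr (Fin.castAdd (c₁ :: rest).length b)) with hv
  have hrow1 : ∀ b : Fin (k + 1), ((dataK base (c₁ :: rest) (fun _ _ => false)).monskyEvenS *ᵥ z) (Sum.inl (Fin.castAdd _ b)) = 0 :=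
    fun b => by rw [hz]; rfl
  have hrow2 : ∀ b : Fin (k + 1), ((dataK base (c₁ :: rest) (fun _ _ => false)).monskyEvenS *ᵥ z) (Sum.inr (Fin.castAdd _ b)) = 0 :=
    fun b => by rw [hz]; rfl
  have hA : ∀ j, ((dataK base (c₁ :: rest) (fun _ _ => false)).monskyEvenS *ᵥ z) (Sum.inl (Fin.natAdd (k + 1) j)) = 0 :=
    fun j => by rw [hz]; rfl
  have hB : ∀ j, ((dataK base (c₁ :: rest) (fun _ _ => false)).monskyEvenS *ᵥ z) (Sum.inr (Fin.natAdd (k + 1) j)) = 0 :=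
    fun j => by rw [hz]; rfl
  obtain ⟨E1, E2, -, E4⟩ := even_design_identities base c₁ rest hm1 hmr σ hσ hσ1 dp hdp hd1 z hrow1 hrow2
    (Finset.sum_eq_zero fun j _ => hA j) (Finset.sum_eq_zero fun j _ => hB j)
  have hcU : ∀ i, U i = U0 := fun i =>
    (hconst (Fin.natAdd (k + 1) (⟨i.val + 1, by simp⟩ : Fin (c₁ :: rest).length)) (Fin.natAdd (k + 1) q0)
      (auxQ_natAdd _ _) (auxQ_natAdd _ _)).1
  have hcV : ∀ i, V i = V0 := fun i =>
    (hconst (Fin.natAdd (k + 1) (⟨i.val + 1, by simp⟩ : Fin (c₁ :: rest).length)) (Fin.natAdd (k + 1) q0)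
      (auxQ_natAdd _ _) (auxQ_natAdd _ _)).2
  have ha0 : ∀ i, U i + U0 = 0 := fun i => by rw [hcU i]; exact zmod_two_add_self _
  have he0 : ∀ i, V i + V0 = 0 := fun i => by rw [hcV i]; exact zmod_two_add_self _
  have hE1 : ∀ b, (∑ b', bz (base.neg b b') * (u b' + u b)) +
      bz (negNegOne (base.cls b)) * (∑ b', bz (negNegOne (base.cls b')) * u b') +
      bz (negTwo (base.cls b)) * u b + bz (negNegOne (base.cls b)) * v b = 0 := by
    intro b
    have h : (∑ b', bz (base.neg b b') * (u b' + u b)) +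
        bz (negNegOne (base.cls b)) * (∑ b', bz (negNegOne (base.cls b')) * u b') +
        bz (negTwo (base.cls b)) * u b + bz (negNegOne (base.cls b)) * v b = ∑ i, σ i b * (U i + U0) := E1 b
    rw [h]; exact Finset.sum_eq_zero fun i _ => by rw [ha0 i, mul_zero]
  have hE2 : ∀ b, bz (negTwo (base.cls b)) * u b + (∑ b', bz (base.neg b b') * (v b' + v b)) +
      bz (negNegOne (base.cls b)) * v b + bz (negTwo (base.cls b)) * v b + bz (negNegOne (base.cls b)) * V0 = 0 := by
    intro b
    have h : bz (negTwo (base.cls b)) * u b + (∑ b', bz (base.neg b b') * (v b' + v b)) +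
        bz (negNegOne (base.cls b)) * v b + bz (negTwo (base.cls b)) * v b + bz (negNegOne (base.cls b)) * V0 =
        ∑ i, σ i b * (V i + V0) := E2 b
    rw [h]; exact Finset.sum_eq_zero fun i _ => by rw [he0 i, mul_zero]
  have hE4 : V0 = ∑ b', bz (negNegOne (base.cls b')) * u b' := by
    have h : V0 = (∑ b', bz (negNegOne (base.cls b')) * u b') + ∑ i, ((∑ b', σ i b') + dp i) * (U i + U0) := E4
    rw [h]
    have h0 : (∑ i, ((∑ b', σ i b') + dp i) * (U i + U0)) = 0 := Finset.sum_eq_zero fun i _ => by rw [ha0 i, mul_zero]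
    rw [h0, add_zero]
  -- the rows of the free cells
  have hS : ∀ i : Fin rest.length, ((c₁ :: rest).getD ((⟨i.val + 1, by simp⟩ : Fin (c₁ :: rest).length) : ℕ) (0, 0)) =
      rest.getD i.val (0, 0) := fun i => rfl
  have bz0 : bz false = (0 : ZMod 2) := rfl
  have T1 : ∀ i : Fin rest.length, (∑ b, σ i b * u b) + ((∑ b, σ i b) + dp i) * U0 = 0 := by
    intro i
    have h := hA ⟨i.val + 1, by simp⟩
    rw [mulVecEven_inl_natAdd_expand, sum_bz_neg_aux_aux_design base c₁ rest hmr, add_zero] at h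
    simp only [bz_neg_tail_castAdd base c₁ rest hmr σ hσ, hS, hdp, hmr, Bool.false_and, bz0, zero_mul,
      Finset.sum_const_zero, ite_self, add_zero] at h
    have hUi : z (Sum.inl (Fin.natAdd (k + 1) (⟨i.val + 1, by simp⟩ : Fin (c₁ :: rest).length))) = U0 := hcU i
    rw [hUi] at h
    have h' : (∑ b, σ i b * (u b + U0)) + dp i * U0 = 0 := h
    rw [sum_mul_add_const] at h'
    linear_combination (norm := skip) h'
    ring_nf
  have T2 : ∀ i : Fin rest.length, (∑ b, σ i b * v b) + (∑ b, σ i b) * V0 + dp i * (U0 + V0) = 0 := by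
    intro i
    have h := hB ⟨i.val + 1, by simp⟩
    rw [mulVecEven_inr_natAdd_expand, sum_bz_neg_aux_aux_design base c₁ rest hmr, add_zero] at h
    simp only [bz_neg_tail_castAdd base c₁ rest hmr σ hσ, hS, hdp] at h
    have hUi : z (Sum.inl (Fin.natAdd (k + 1) (⟨i.val + 1, by simp⟩ : Fin (c₁ :: rest).length))) = U0 := hcU i
    have hVi : z (Sum.inr (Fin.natAdd (k + 1) (⟨i.val + 1, by simp⟩ : Fin (c₁ :: rest).length))) = V0 := hcV i
    rw [hUi, hVi] at h
    have h' : dp i * U0 + (∑ b, σ i b * (v b + V0)) + dp i * V0 = 0 := h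
    rw [sum_mul_add_const] at h'
    linear_combination (norm := skip) h'
    ring_nf
  obtain ⟨hu0, hv0, hU00, hV00⟩ := hF u v U0 V0 hE1 hE2 hE4 T1 T2
  have hub : ∀ b, u b = 0 := fun b => by have := congrFun hu0 b; simpa using this
  have hvb : ∀ b, v b = 0 := fun b => by have := congrFun hv0 b; simpa using this
  funext idx
  rcases idx with i | i
  · refine Fin.addCases (fun b => ?_) (fun j => ?_) i
    · exact hub b
    · rcases fin_cons_cases c₁ rest j with rfl | ⟨i', rfl⟩
      · exact hU00
      · rw [Pi.zero_apply]; exact (hcU i').trans hU00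
  · refine Fin.addCases (fun b => ?_) (fun j => ?_) i
    · exact hvb b
    · rcases fin_cons_cases c₁ rest j with rfl | ⟨i', rfl⟩
      · exact hV00
      · rw [Pi.zero_apply]; exact (hcV i').trans hV00

end EvenDesign

end Summit.BirchSwinnertonDyer.BirchSwinnertonDyer.Theorems.SymbolicMonsky
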